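import Mathlib
import Literature.Computability.AlgebraicComplexity.AsymptoticSpectrum
import Literature.Computability.AlgebraicComplexity.BorderRankCW

/-!
# Reading the slices of `cw₂^{⊠N}` letter by letter — no slice is a non-zero outer product
(decomp-mm lens 4 «minimal-counterexample / extremal reduction», gen 37; kernel K37-1a, THESES-FREE:
imports `Literature` only)

ω-free, route-independent facts about the little Coppersmith–Winograd tensor `cw₂` (on `Fin 3`,
support `{(0,i,i),(i,0,i),(i,i,0) : i = 1,2}`) and the first-mode slices
`T(η)(b,c) = Σₐ η(a) · cw₂^{⊠N}(a,b,c)` of its Kronecker powers: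

* `cw_base`: the words `σ_b = (1,0,0)∘a`, `σ_c = (1,1,2)∘a` READ the word `a`
  (`cw₂(y, σ_b(a_p), σ_c(a_p)) = [y = a_p]`), so `T(η)(σ_b∘a, σ_c∘a) = η(a)`; more generally
  `cwPow_slice_entry`: changing one coordinate `p₀` of the two words to a position `(j,k)` that reads
  the letter `x` gives the entry `η(a with a_{p₀} := x)`, and a position outside the support gives `0`
  (`cwPow_slice_entry_zero`).
* `false_of_cwPow_slice_eq_outer`: for `N ≥ 1` no slice `T(η)` with `η ≠ 0` is an outer product
  `u vᵀ` — in the first coordinate of a word `a` with `η(a) ≠ 0` one finds a `2 × 2` minor of `T(η)`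
  equal to `η(a)²`, while all `2 × 2` minors of `u vᵀ` vanish.  (Rank-free form of «`cw₂^{⊠N}` has
  no rank-one slice»; used by `Theorems/OutsiderSandwichNoExactPerfectPacking` to exclude
  `cw₂^{⊠N} ≅ ⟨3^N⟩`.)
-/

set_option linter.dupNamespace false

namespace Summit.MatrixMultiplication.MatrixMultiplication.Theorems.OutsiderSandwichCwPowSliceReading

open Literature.Computability.AlgebraicComplexity

/-! ## 1. Positions of `cw₂` reading letters -/

/-- The base admissible pattern: `cw₂(y, σ_b z, σ_c z) = [y = z]` for `σ_b = (1,0,0)`, `σ_c = (1,1,2)`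
(the letter `0` is read at position `(1,1)`, the letter `1` at `(0,1)`, the letter `2` at `(0,2)`).
[new] -/
theorem cw_base (y z : Fin 3) :
    cwTensor ℂ 2 y ((![1, 0, 0] : Fin 3 → Fin 3) z) ((![1, 1, 2] : Fin 3 → Fin 3) z) =
      if y = z then 1 else 0 := by
  fin_cases y <;> fin_cases z <;> simp [cwTensor_apply]

/-- position `(1,1)` reads the letter `0`. [folklore] -/
theorem cw_one_one (y : Fin 3) : cwTensor ℂ 2 y 1 1 = if y = 0 then 1 else 0 := by
  fin_cases y <;> simp [cwTensor_apply]

/-- position `(2,2)` reads the letter `0`. [folklore] -/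
theorem cw_two_two (y : Fin 3) : cwTensor ℂ 2 y 2 2 = if y = 0 then 1 else 0 := by
  fin_cases y <;> simp [cwTensor_apply]

/-- position `(0,1)` reads the letter `1`. [folklore] -/
theorem cw_zero_one (y : Fin 3) : cwTensor ℂ 2 y 0 1 = if y = 1 then 1 else 0 := by
  fin_cases y <;> simp [cwTensor_apply]

/-- position `(1,0)` reads the letter `1`. [folklore] -/
theorem cw_one_zero (y : Fin 3) : cwTensor ℂ 2 y 1 0 = if y = 1 then 1 else 0 := by
  fin_cases y <;> simp [cwTensor_apply]

/-- position `(0,2)` reads the letter `2`. [folklore] -/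
theorem cw_zero_two (y : Fin 3) : cwTensor ℂ 2 y 0 2 = if y = 2 then 1 else 0 := by
  fin_cases y <;> simp [cwTensor_apply]

/-- position `(2,0)` reads the letter `2`. [folklore] -/
theorem cw_two_zero (y : Fin 3) : cwTensor ℂ 2 y 2 0 = if y = 2 then 1 else 0 := by
  fin_cases y <;> simp [cwTensor_apply]

/-- position `(1,2)` is outside the support. [folklore] -/
theorem cw_one_two (y : Fin 3) : cwTensor ℂ 2 y 1 2 = 0 := by
  fin_cases y <;> simp [cwTensor_apply]

/-- position `(2,1)` is outside the support. [folklore] -/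
theorem cw_two_one (y : Fin 3) : cwTensor ℂ 2 y 2 1 = 0 := by
  fin_cases y <;> simp [cwTensor_apply]

/-- position `(0,0)` is outside the support. [folklore] -/
theorem cw_zero_zero (y : Fin 3) : cwTensor ℂ 2 y 0 0 = 0 := by
  fin_cases y <;> simp [cwTensor_apply]

/-- **Letter-by-letter reading of a slice of `cw₂^{⊠N}`.**  If the words `rb, cb` read the word
`a` (coordinatewise `cw₂(y, rb p, cb p) = [y = a p]`) and position `(j,k)` reads the letter `x`,
then the slice `T(η) = Σₐ η(a) cw₂^{⊠N}(a,·,·)` has entry `η(a with letter x at p₀)` at the words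
obtained by putting `(j,k)` at coordinate `p₀`. [new] -/
theorem cwPow_slice_entry {N : ℕ} (η : (Fin N → Fin 3) → ℂ) {a rb cb : Fin N → Fin 3}
    (hbase : ∀ p y, cwTensor ℂ 2 y (rb p) (cb p) = if y = a p then 1 else 0) (p₀ : Fin N)
    {j k x : Fin 3} (hx : ∀ y : Fin 3, cwTensor ℂ 2 y j k = if y = x then 1 else 0) :
    (∑ a', η a' * kroneckerPow (cwTensor ℂ 2) N a' (Function.update rb p₀ j) (Function.update cb p₀ k)) =
      η (Function.update a p₀ x) := by
  classical
  have hprod : ∀ a' : Fin N → Fin 3,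
      (∏ p, cwTensor ℂ 2 (a' p) (Function.update rb p₀ j p) (Function.update cb p₀ k p)) =
        if a' = Function.update a p₀ x then 1 else 0 := by
    intro a'
    have hfac : ∀ p, cwTensor ℂ 2 (a' p) (Function.update rb p₀ j p) (Function.update cb p₀ k p) =
        if a' p = Function.update a p₀ x p then 1 else 0 := by
      intro p
      by_cases hp : p = p₀
      · subst hp
        simp only [Function.update_self]
        exact hx (a' p)
      · simp only [Function.update_of_ne hp]
        exact hbase p (a' p)
    simp_rw [hfac, Fintype.prod_boole]
    by_cases hw : a' = Function.update a p₀ x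
    · rw [if_pos hw, if_pos (fun i => congrFun hw i)]
    · rw [if_neg hw, if_neg (fun hall => hw (funext hall))]
  simp only [kroneckerPow_apply, hprod, mul_ite, mul_one, mul_zero, Finset.sum_ite_eq',
    Finset.mem_univ, if_true]

/-- At a position outside the support the slice entry vanishes, whatever the other coordinates.
[new] -/
theorem cwPow_slice_entry_zero {N : ℕ} (η : (Fin N → Fin 3) → ℂ) (rb cb : Fin N → Fin 3)
    (p₀ : Fin N) {j k : Fin 3} (h0 : ∀ y : Fin 3, cwTensor ℂ 2 y j k = 0) :
    (∑ a', η a' * kroneckerPow (cwTensor ℂ 2) N a' (Function.update rb p₀ j) (Function.update cb p₀ k)) =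
      0 := by
  classical
  simp only [kroneckerPow_apply]
  refine Finset.sum_eq_zero fun a' _ => ?_
  have : (∏ p, cwTensor ℂ 2 (a' p) (Function.update rb p₀ j p) (Function.update cb p₀ k p)) = 0 :=
    Finset.prod_eq_zero (Finset.mem_univ p₀) (by simp only [Function.update_self]; exact h0 (a' p₀))
  rw [this, mul_zero]

/-! ## 2. No slice of `cw₂^{⊠N}` (`N ≥ 1`) is a non-zero outer product -/

/-- The minimal-counterexample step: if words `rb, cb` read a word `a` with `η(a) ≠ 0`, the slice
`T(η)` of `cw₂^{⊠N}` is not an outer product `u vᵀ` — in the first coordinate one finds a `2 × 2`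
minor equal to `η(a)²`. [new] -/
theorem false_of_outer_of_reads {N : ℕ} (hN : 1 ≤ N) {η : (Fin N → Fin 3) → ℂ}
    {a rb cb : Fin N → Fin 3} (ha : η a ≠ 0)
    (hbase : ∀ p y, cwTensor ℂ 2 y (rb p) (cb p) = if y = a p then 1 else 0)
    {u v : (Fin N → Fin 3) → ℂ}
    (huv : ∀ b c, (∑ a', η a' * kroneckerPow (cwTensor ℂ 2) N a' b c) = u b * v c) : False := by
  classical
  obtain ⟨p₀⟩ : Nonempty (Fin N) := ⟨⟨0, hN⟩⟩
  -- the 2 × 2 minors of an outer product vanish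
  have minor : ∀ b₁ b₂ c₁ c₂ : Fin N → Fin 3,
      (∑ a', η a' * kroneckerPow (cwTensor ℂ 2) N a' b₁ c₁) *
          (∑ a', η a' * kroneckerPow (cwTensor ℂ 2) N a' b₂ c₂) =
        (∑ a', η a' * kroneckerPow (cwTensor ℂ 2) N a' b₁ c₂) *
          (∑ a', η a' * kroneckerPow (cwTensor ℂ 2) N a' b₂ c₁) := by
    intro b₁ b₂ c₁ c₂
    rw [huv, huv, huv, huv]
    ring
  have h3 : ∀ i : Fin 3, i = 0 ∨ i = 1 ∨ i = 2 := by decide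
  rcases h3 (a p₀) with h0 | h1 | h2
  · -- first letter `0`: rows `1, 2`, columns `1, 2`
    have hupd : Function.update a p₀ 0 = a := by rw [← h0]; exact Function.update_eq_self _ _
    have e11 := cwPow_slice_entry η hbase p₀ cw_one_one
    have e22 := cwPow_slice_entry η hbase p₀ cw_two_two
    have e12 := cwPow_slice_entry_zero η rb cb p₀ cw_one_two
    have e21 := cwPow_slice_entry_zero η rb cb p₀ cw_two_one
    rw [hupd] at e11 e22
    have key := minor (Function.update rb p₀ 1) (Function.update rb p₀ 2)
      (Function.update cb p₀ 1) (Function.update cb p₀ 2)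
    rw [e11, e22, e12, e21, zero_mul] at key
    exact ha (mul_self_eq_zero.mp key)
  · -- first letter `1`: rows `0, 1`, columns `1, 0`
    have hupd : Function.update a p₀ 1 = a := by rw [← h1]; exact Function.update_eq_self _ _
    have e01 := cwPow_slice_entry η hbase p₀ cw_zero_one
    have e10 := cwPow_slice_entry η hbase p₀ cw_one_zero
    have e00 := cwPow_slice_entry_zero η rb cb p₀ cw_zero_zero
    rw [hupd] at e01 e10
    have key := minor (Function.update rb p₀ 0) (Function.update rb p₀ 1)
      (Function.update cb p₀ 1) (Function.update cb p₀ 0)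
    rw [e01, e10, e00, zero_mul] at key
    exact ha (mul_self_eq_zero.mp key)
  · -- first letter `2`: rows `0, 2`, columns `2, 0`
    have hupd : Function.update a p₀ 2 = a := by rw [← h2]; exact Function.update_eq_self _ _
    have e02 := cwPow_slice_entry η hbase p₀ cw_zero_two
    have e20 := cwPow_slice_entry η hbase p₀ cw_two_zero
    have e00 := cwPow_slice_entry_zero η rb cb p₀ cw_zero_zero
    rw [hupd] at e02 e20
    have key := minor (Function.update rb p₀ 0) (Function.update rb p₀ 2)
      (Function.update cb p₀ 2) (Function.update cb p₀ 0)
    rw [e02, e20, e00, zero_mul] at key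
    exact ha (mul_self_eq_zero.mp key)

/-- **`cw₂^{⊠N}` (`N ≥ 1`) has no non-zero slice of rank one**, in the rank-free form: no slice
`T(η)`, `η ≠ 0`, is an outer product `u vᵀ`. [new] -/
theorem false_of_cwPow_slice_eq_outer {N : ℕ} (hN : 1 ≤ N) {η : (Fin N → Fin 3) → ℂ}
    (hη : η ≠ 0) {u v : (Fin N → Fin 3) → ℂ}
    (huv : ∀ b c, (∑ a', η a' * kroneckerPow (cwTensor ℂ 2) N a' b c) = u b * v c) : False := by
  classical
  obtain ⟨a, ha⟩ : ∃ a, η a ≠ 0 := Function.ne_iff.mp hη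
  exact false_of_outer_of_reads hN ha (rb := fun p => (![1, 0, 0] : Fin 3 → Fin 3) (a p))
    (cb := fun p => (![1, 1, 2] : Fin 3 → Fin 3) (a p)) (fun p y => cw_base y (a p)) huv

end Summit.MatrixMultiplication.MatrixMultiplication.Theorems.OutsiderSandwichCwPowSliceReading
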